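import Mathlib

/-!
# The product-free (Kedlaya) template is never a quotient triple

Crux `Summit.MatrixMultiplication.MatrixMultiplication.Theses.SnSubsetDichotomy.PolynomialSlack`
(item `stmt-MatrixMultiplication-8306`), level-one programme, lead c5, line transport-split-hull.

For `S, T, U ⊆ S_n` the three (injectively parametrised) pair quotient sets are `A = S⁻¹T`, `B = T⁻¹U`,
`C = U⁻¹S`. The extremisers of the product-free bound in `S_n` have the TEMPLATE: every `a ∈ A` maps a
position `p` into `R`, every `b ∈ B` has `b⁻¹ p ∈ R'`, and every `c ∈ C` maps `R` outside `R'`. With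
`a = s⁻¹t`, `b = t⁻¹u`, `c = u⁻¹s` and `r := s⁻¹(t p) ∈ R` one gets `(u⁻¹s) r = u⁻¹(t p) = (t⁻¹u)⁻¹ p ∈ R'`,
a contradiction. This file records

* `no_kedlaya_quotient_triple` — the exact form: the template is inconsistent as soon as `S, T, U` are
  nonempty;
* `kedlaya_template_count_le` — the robust counting form: the three template events cannot hold
  simultaneously on any triple `(s, t, u)`, so their cylinder counts sum to at most `2|S||T||U|`.
-/

namespace Summit.MatrixMultiplication.MatrixMultiplication.Theorems.PolynomialSlack

open scoped BigOperators

-- `Summit.<Summit>.<Problem>` is the tree's mandated summit-side namespace (CONVENTIONS §2); for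
-- this single-conjunct summit the two coincide, so each declaration silences `dupNamespace`.
set_option linter.dupNamespace false

/-- Pointwise form of the template obstruction on one triple `(s, t, u)`: if `s⁻¹(t p) ∈ R`,
`(t⁻¹u)⁻¹ p = u⁻¹(t p) ∈ R'` and `u⁻¹s` maps `R` outside `R'`, then `r := s⁻¹(t p)` is a witness of the
contradiction `(u⁻¹s) r = u⁻¹(t p) ∈ R'`. [folklore] -/
theorem kedlaya_template_pointwise {n : ℕ} {s t u : Equiv.Perm (Fin n)} {p : Fin n}
    {R R' : Finset (Fin n)} (h1 : (s⁻¹ * t) p ∈ R) (h2 : (t⁻¹ * u)⁻¹ p ∈ R')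
    (h3 : ∀ r ∈ R, (u⁻¹ * s) r ∉ R') : False := by
  refine h3 _ h1 ?_
  simpa [Equiv.Perm.mul_apply, mul_inv_rev] using h2

/-- KEDLAYA TEMPLATE OBSTRUCTION (exact form): for nonempty `S, T, U ⊆ S_n` the quotient sets
`S⁻¹T`, `T⁻¹U`, `U⁻¹S` never satisfy the product-free template (`(s⁻¹t) p ∈ R`, `(t⁻¹u)⁻¹ p ∈ R'`,
`(u⁻¹s)(R) ∩ R' = ∅`). [folklore] -/
theorem no_kedlaya_quotient_triple {n : ℕ} {S T U : Finset (Equiv.Perm (Fin n))}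
    (hS : S.Nonempty) (hT : T.Nonempty) (hU : U.Nonempty) (p : Fin n) (R R' : Finset (Fin n))
    (hA : ∀ s ∈ S, ∀ t ∈ T, (s⁻¹ * t) p ∈ R)
    (hB : ∀ t ∈ T, ∀ u ∈ U, (t⁻¹ * u)⁻¹ p ∈ R')
    (hC : ∀ u ∈ U, ∀ s ∈ S, ∀ r ∈ R, (u⁻¹ * s) r ∉ R') : False := by
  obtain ⟨s, hs⟩ := hS
  obtain ⟨t, ht⟩ := hT
  obtain ⟨u, hu⟩ := hU
  exact kedlaya_template_pointwise (hA s hs t ht) (hB t ht u hu) (hC u hu s hs)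

/-- Abstract cyclic three-event counting bound: if the events `P ⊆ A × B`, `Q ⊆ B × C`, `W ⊆ C × A`
never hold simultaneously around a triple `(a, b, c) ∈ A × B × C`, then their cylinder counts in
`A × B × C` sum to at most `2|A||B||C|` (sum the pointwise bound `𝟙P + 𝟙Q + 𝟙W ≤ 2`). [folklore] -/
theorem card_filter_cyclic_three_le {α β γ : Type*} (A : Finset α) (B : Finset β)
    (C : Finset γ) (P : α × β → Prop) (Q : β × γ → Prop) (W : γ × α → Prop)
    [DecidablePred P] [DecidablePred Q] [DecidablePred W]
    (h : ∀ a ∈ A, ∀ b ∈ B, ∀ c ∈ C, P (a, b) → Q (b, c) → ¬ W (c, a)) :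
    ((A ×ˢ B).filter P).card * C.card + ((B ×ˢ C).filter Q).card * A.card +
        ((C ×ˢ A).filter W).card * B.card ≤ 2 * (A.card * B.card * C.card) := by
  have e₁ : ((A ×ˢ B).filter P).card * C.card =
      ∑ a ∈ A, ∑ b ∈ B, ∑ _c ∈ C, (if P (a, b) then 1 else 0) := by
    rw [Finset.card_filter, Finset.sum_product, Finset.sum_mul]
    refine Finset.sum_congr rfl fun a _ => ?_
    rw [Finset.sum_mul]
    refine Finset.sum_congr rfl fun b _ => ?_
    rw [Finset.sum_const, smul_eq_mul, mul_comm]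
  have e₂ : ((B ×ˢ C).filter Q).card * A.card =
      ∑ _a ∈ A, ∑ b ∈ B, ∑ c ∈ C, (if Q (b, c) then 1 else 0) := by
    rw [Finset.card_filter, Finset.sum_product, Finset.sum_const, smul_eq_mul, mul_comm]
  have e₃ : ((C ×ˢ A).filter W).card * B.card =
      ∑ a ∈ A, ∑ _b ∈ B, ∑ c ∈ C, (if W (c, a) then 1 else 0) := by
    rw [Finset.card_filter, Finset.sum_product_right, Finset.sum_mul]
    refine Finset.sum_congr rfl fun a _ => ?_
    rw [Finset.sum_const, smul_eq_mul, mul_comm]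
  have key : ∀ a ∈ A, ∀ b ∈ B, ∀ c ∈ C,
      (if P (a, b) then 1 else 0) + (if Q (b, c) then 1 else 0) +
        (if W (c, a) then 1 else 0) ≤ 2 := by
    intro a ha b hb c hc
    by_cases hP : P (a, b)
    · by_cases hQ : Q (b, c)
      · have hW : ¬ W (c, a) := h a ha b hb c hc hP hQ
        simp [hP, hQ, hW]
      · by_cases hW : W (c, a) <;> simp [hP, hQ, hW]
    · by_cases hQ : Q (b, c) <;> by_cases hW : W (c, a) <;> simp [hP, hQ, hW]
  calc ((A ×ˢ B).filter P).card * C.card + ((B ×ˢ C).filter Q).card * A.card +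
        ((C ×ˢ A).filter W).card * B.card
      = ∑ a ∈ A, ∑ b ∈ B, ∑ c ∈ C, ((if P (a, b) then 1 else 0) +
          (if Q (b, c) then 1 else 0) + (if W (c, a) then 1 else 0)) := by
        rw [e₁, e₂, e₃]
        simp only [Finset.sum_add_distrib]
    _ ≤ ∑ _a ∈ A, ∑ _b ∈ B, ∑ _c ∈ C, 2 :=
        Finset.sum_le_sum fun a ha => Finset.sum_le_sum fun b hb =>
          Finset.sum_le_sum fun c hc => key a ha b hb c hc
    _ = 2 * (A.card * B.card * C.card) := by
        simp only [Finset.sum_const, smul_eq_mul]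
        ring

/-- KEDLAYA TEMPLATE OBSTRUCTION (robust counting form): the three template events
`E₁(s,t) : (s⁻¹t) p ∈ R`, `E₂(t,u) : (t⁻¹u)⁻¹ p ∈ R'`, `E₃(u,s) : (u⁻¹s)(R) ∩ R' = ∅` cannot hold
simultaneously on any triple `(s, t, u)`, so their weighted counts sum to at most `2|S||T||U|`.
[folklore] -/
theorem kedlaya_template_count_le {n : ℕ} (S T U : Finset (Equiv.Perm (Fin n)))
    (p : Fin n) (R R' : Finset (Fin n)) :
    ((S ×ˢ T).filter fun st => (st.1⁻¹ * st.2) p ∈ R).card * U.card +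
      ((T ×ˢ U).filter fun tu => (tu.1⁻¹ * tu.2)⁻¹ p ∈ R').card * S.card +
      ((U ×ˢ S).filter fun us => ∀ r ∈ R, (us.1⁻¹ * us.2) r ∉ R').card * T.card ≤
      2 * (S.card * T.card * U.card) :=
  card_filter_cyclic_three_le S T U (fun st => (st.1⁻¹ * st.2) p ∈ R)
    (fun tu => (tu.1⁻¹ * tu.2)⁻¹ p ∈ R') (fun us => ∀ r ∈ R, (us.1⁻¹ * us.2) r ∉ R')
    fun _ _ _ _ _ _ h1 h2 h3 => kedlaya_template_pointwise h1 h2 h3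

end Summit.MatrixMultiplication.MatrixMultiplication.Theorems.PolynomialSlack
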